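import Literature.NumberTheory.LFunctions.AbelianFrobeniusNaturalDensity
import Literature.NumberTheory.GaloisRepresentations.ArtinCharacterReciprocityProofs
import Literature.NumberTheory.GaloisRepresentations.ChebotarevCyclicProofs
import Literature.NumberTheory.GaloisRepresentations.ChebotarevCyclotomicProofs
import HarnessLib

/-!
# Chebotarev's density theorem in natural-density form: the cyclic case

Topic `Literature/NumberTheory/LFunctions`; namespace `Literature.NumberTheory.LFunctions.Chebotarev`.
Pure-proof file (theorems only; no definition, no named fact).  Step "We first assume that `G` is
generated by `σ`" of Neukirch's proof of VII (13.4), in NATURAL-density form: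

**Theorem** (`tendsto_sum_primeNormCount_frobenius_eq_mul_log_div`).  Let `L/E` be a finite Galois
extension of number fields with CYCLIC group and `σ ∈ Gal(L/E)`.  Then the set
`S_σ = {𝔮 ⊆ 𝓞_E unramified in L : every arithmetic Frobenius of L/E above 𝔮 equals σ}` satisfies
`#{𝔮 ∈ S_σ : N𝔮 ≤ N} · log N / N → 1/[L:E]`, i.e. `π_σ(x) ∼ x / ([L:E] log x)` — the primes with
Frobenius `σ` have natural density `1/[L:E]`.

Proof: the abelian natural-density theorem
`AbelianDensity.tendsto_sum_primeNormCount_frobFiber_mul_log_div` (`AbelianFrobeniusNaturalDensity.lean`: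
Hecke–Landau non-vanishing on `Re s = 1` + Wiener–Ikehara) applied to the Frobenius datum
`𝔮 ↦ Frob_𝔮 ∈ Gal(L/E)` (transported into the range of a faithful character `χ₀ : Gal(L/E) ↪ ℂˣ`, a finite
abelian group), whose two hypotheses are theorems of the tree:

* (i) the Artin symbol kills the narrow ray modulo the admissible modulus `𝔪` of `L/E` — **Artin's
  reciprocity law for the cyclic extension `L/E`** (`GaloisRepresentations.artinKillsRay_of_finrank_le_relIndex`
  fed with the global cyclic norm index inequality `GaloisRepresentations.IdeleHerbrand.globalCyclicNormIndex`,
  Childress Thm. 5.12 / Thm. 2.1; Neukirch VI (7.1));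
* (iii) a non-trivial character of `Gal(L/E) = ⟨g⟩` is `≠ 1` at `g`, and `g` IS the Frobenius of some
  unramified prime — the existence form of Chebotarev's theorem in the cyclic case
  (`GaloisRepresentations.infinite_setOf_frobenius_eq_of_isCyclic` with the proved cyclotomic case
  `chebotarev_cyclotomicExtension_holds`; any one such prime suffices).

The modulus `𝔪` is supported exactly on the primes ramified in `L`, so the fibre
`{𝔮 ∤ 𝔪 : Frob_𝔮 = σ}` of the datum is `S_σ` (`eq_galFrob`: in an abelian extension every Frobenius above
an unramified `𝔮` is THE Frobenius `galFrob E L 𝔮`).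

## References

* J. Neukirch, *Algebraic Number Theory*, Springer 1999, VII (13.4) and its proof (first step), (13.2),
  VI (7.1). [NeukirchANT1999]
* N. Childress, *Class Field Theory*, Springer 2009, Ch. 4 Thm. 5.12, Ch. 5 Thm. 2.1. [Childress2009]
* J.-P. Serre, *Quelques applications du théorème de densité de Chebotarev*, Publ. Math. IHÉS 54 (1981),
  §2.1 Thm. 1 with (9). [Serre1981]
-/

noncomputable section

open Filter NumberField IsDedekindDomain Finset

open scoped _root_.Topology Classical

namespace Literature.NumberTheory.LFunctions.Chebotarev

open GaloisRepresentations AbelianDensity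

variable {E L : Type} [Field E] [NumberField E] [Field L] [NumberField L] [Algebra E L]
  [IsGalois E L] [IsCyclic (L ≃ₐ[E] L)]

omit [NumberField E] [NumberField L] [IsGalois E L] in
/-- In a cyclic (hence abelian) extension the Galois group is commutative. [folklore] -/
theorem commute_of_isCyclic (a b : L ≃ₐ[E] L) : Commute a b :=
  IsCyclic.isMulCommutative.is_comm.comm a b

/-- **The Frobenius set `S_σ` as a fibre of `galFrob`.**  For `L/E` abelian and `𝔪` supported exactly on the
ramified primes, `{𝔮 ∤ 𝔪 : e(Frob_𝔮) = e σ} = S_σ` for any injective map `e` on `Gal(L/E)`: above an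
unramified `𝔮` every Frobenius is `galFrob E L 𝔮` (`eq_galFrob`). [folklore] -/
theorem frobFiber_comp_galFrob_eq {G₀ : Type*} {e : (L ≃ₐ[E] L) → G₀} (he : Function.Injective e)
    {𝔪 : Ideal (𝓞 E)}
    (hiff : ∀ v : HeightOneSpectrum (𝓞 E), 𝔪 ≤ v.asIdeal ↔ ¬ Algebra.IsUnramifiedIn (𝓞 L) v.asIdeal)
    (σ : L ≃ₐ[E] L) :
    {v : HeightOneSpectrum (𝓞 E) | ¬ 𝔪 ≤ v.asIdeal ∧ (fun v => e (galFrob E L v)) v = e σ} =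
      {v : HeightOneSpectrum (𝓞 E) | Algebra.IsUnramifiedIn (𝓞 L) v.asIdeal ∧
        ∀ Q ∈ v.asIdeal.primesOver (𝓞 L), ∀ φ : L ≃ₐ[E] L, IsArithFrobAt (𝓞 E) φ Q → φ = σ} := by
  ext v
  simp only [Set.mem_setOf_eq]
  have hunr_iff : ¬ 𝔪 ≤ v.asIdeal ↔ Algebra.IsUnramifiedIn (𝓞 L) v.asIdeal := by
    rw [hiff v, not_not]
  constructor
  · rintro ⟨hm, he'⟩
    have hunr := hunr_iff.mp hm
    have hσ : galFrob E L v = σ := he he'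
    refine ⟨hunr, fun Q hQ φ hφ => ?_⟩
    rw [eq_galFrob commute_of_isCyclic hunr hQ hφ, hσ]
  · rintro ⟨hunr, hall⟩
    refine ⟨hunr_iff.mpr hunr, ?_⟩
    obtain ⟨Q, hQ, hfrob⟩ := galFrob_spec E L v
    show e (galFrob E L v) = e σ
    rw [hall Q hQ _ hfrob]

/-- **The prime ideal theorem for Frobenius classes of a cyclic extension (Chebotarev, cyclic case,
natural density).**  Let `L/E` be a finite Galois extension of number fields with cyclic Galois group and
`σ ∈ Gal(L/E)`.  Then, with `S_σ` the set of primes `𝔮` of `E` unramified in `L` all of whose arithmetic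
Frobenii equal `σ`: `(Σ_{n ≤ N} #{𝔮 ∈ S_σ : N𝔮 = n}) · log N / N → 1/[L:E]`, i.e. `S_σ` has natural
density `1/[L:E]` (`π_{S_σ}(x) ∼ x/([L:E] log x)`).  Artin reciprocity for `L/E` makes `𝔮 ↦ χ(Frob_𝔮)` a
ray class character for every character `χ` of `Gal(L/E)`, and the abelian natural-density theorem
(Hecke–Landau + Wiener–Ikehara) applies; Neukirch's first step of the proof of (13.4) with (13.2) replaced
by its natural-density form. [cite: NeukirchANT1999, VII (13.4) proof (first step) with VI (7.1)] -/
theorem tendsto_sum_primeNormCount_frobenius_eq_mul_log_div (σ : L ≃ₐ[E] L) :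
    Tendsto (fun N : ℕ => (∑ n ∈ Icc 1 N, (primeNormCount E
        {v : HeightOneSpectrum (𝓞 E) | Algebra.IsUnramifiedIn (𝓞 L) v.asIdeal ∧
          ∀ Q ∈ v.asIdeal.primesOver (𝓞 L), ∀ φ : L ≃ₐ[E] L, IsArithFrobAt (𝓞 E) φ Q → φ = σ} n : ℝ)) *
        Real.log N / N)
      atTop (𝓝 (1 / Module.finrank E L)) := by
  -- the admissible modulus and the norm index inequality (Artin reciprocity input)
  obtain ⟨𝔪, h𝔪, hiff, hindex⟩ := IdeleHerbrand.globalCyclicNormIndex E L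
  have hram : ∀ v : HeightOneSpectrum (𝓞 E), ¬ 𝔪 ≤ v.asIdeal → Algebra.IsUnramifiedIn (𝓞 L) v.asIdeal :=
    fun v hv => not_not.mp fun hunr => hv ((hiff v).mpr hunr)
  -- a faithful character and the datum in its (finite abelian) range
  obtain ⟨χ₀, hχ₀⟩ := exists_monoidHom_units_complex_injective (L ≃ₐ[E] L)
  set e : (L ≃ₐ[E] L) ≃* χ₀.range := MonoidHom.ofInjective hχ₀ with hedef
  set f₀ : HeightOneSpectrum (𝓞 E) → χ₀.range := fun v => e (galFrob E L v) with hf₀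
  haveI : Finite χ₀.range := Finite.of_equiv _ e.toEquiv
  -- (i) Artin reciprocity: the Artin symbol of `f₀` kills the ray `mod 𝔪`
  have h₀ : ArtinKillsRay 𝔪 fun v => χ₀ (galFrob E L v) :=
    artinKillsRay_of_finrank_le_relIndex h𝔪 hram hindex χ₀
  have hray : ArtinKillsRay 𝔪 f₀ := by
    intro b c hb hc hcop hbc hpos
    have hb' : (Ideal.span {b} : Ideal (𝓞 E)) ≠ ⊥ := by simpa [Ideal.span_singleton_eq_bot] using hb
    have hc' : (Ideal.span {c} : Ideal (𝓞 E)) ≠ ⊥ := by simpa [Ideal.span_singleton_eq_bot] using hc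
    apply χ₀.range.subtype_injective
    rw [map_artinSymbol _ f₀ hb', map_artinSymbol _ f₀ hc']
    exact h₀ b c hb hc hcop hbc hpos
  -- (iii) non-trivial characters are non-trivial at the Frobenius of some prime `∤ 𝔪`
  obtain ⟨g, hg⟩ := IsCyclic.exists_generator (α := L ≃ₐ[E] L)
  have hsep : ∀ χ : AddChar (Additive χ₀.range) ℂ, χ ≠ 0 →
      ∃ v : HeightOneSpectrum (𝓞 E), ¬ 𝔪 ≤ v.asIdeal ∧ χ (Additive.ofMul (f₀ v)) ≠ 1 := by
    intro χ hχ
    -- `χ (e g) ≠ 1`, since `e g` generates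
    have hχg : χ (Additive.ofMul (e g)) ≠ 1 := by
      intro h1
      apply hχ
      ext x
      rw [AddChar.zero_apply]
      obtain ⟨y, rfl⟩ : ∃ y : L ≃ₐ[E] L, Additive.ofMul (e y) = x :=
        ⟨e.symm (Additive.toMul x), by simp⟩
      have hy : y ∈ Submonoid.powers g := mem_powers_iff_mem_zpowers.mpr (hg y)
      obtain ⟨k, rfl⟩ := (Submonoid.mem_powers_iff _ _).mp hy
      rw [map_pow, ofMul_pow, AddChar.map_nsmul_eq_pow, h1, one_pow]
    -- a prime with Frobenius `g`, unramified (Chebotarev existence, cyclic case)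
    have hinf := infinite_setOf_frobenius_eq_of_isCyclic chebotarev_cyclotomicExtension_holds g hg
    obtain ⟨v, hv⟩ := hinf.nonempty
    obtain ⟨-, hunr, hall⟩ := hv
    refine ⟨v, fun hm => (hiff v).mp hm hunr, ?_⟩
    obtain ⟨Q, hQ, hfrob⟩ := galFrob_spec E L v
    have hgal : galFrob E L v = g := hall Q hQ _ hfrob
    show χ (Additive.ofMul (e (galFrob E L v))) ≠ 1
    rwa [hgal]
  -- the abelian natural-density theorem for the fibre over `e σ`
  have hmain := tendsto_sum_primeNormCount_frobFiber_mul_log_div h𝔪 hray hsep (e σ)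
  -- identify the fibre with `S_σ` and `|range χ₀|` with `[L:E]`
  have hfib : frobFiber 𝔪 f₀ (e σ) =
      {v : HeightOneSpectrum (𝓞 E) | Algebra.IsUnramifiedIn (𝓞 L) v.asIdeal ∧
        ∀ Q ∈ v.asIdeal.primesOver (𝓞 L), ∀ φ : L ≃ₐ[E] L, IsArithFrobAt (𝓞 E) φ Q → φ = σ} :=
    frobFiber_comp_galFrob_eq (e := fun x => e x) e.injective hiff σ
  have hcard : (Nat.card χ₀.range : ℝ) = Module.finrank E L := by
    rw [← Nat.card_congr e.toEquiv, IsGalois.card_aut_eq_finrank]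
  rw [← hcard, ← hfib]
  exact hmain

end Literature.NumberTheory.LFunctions.Chebotarev

end
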